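import Summits.AtomisticToContinuum.Crystallization.Theorems.PalmUnimodularRigidityLayeredLawsSelectHcpStarGreedyStep
import Literature.MathematicalPhysics.StatisticalMechanics.HcpSiteGeometry

/-!
# A-priori range control of rooted charts: far labels stay far
(stub `tube_farRange` of line `mtp-prestress-split-ergodic-frame`, crux `LayeredLawsSelectHcp`,
stmt-AtomisticToContinuum-9226)

The far field of the rigidity certificate needs pointwise LOWER bounds on the lengths `‖X u‖` of the far
labels `u` of a rooted chart `X : ℤ³ → ℝ³` of an every-point-good configuration `S`
(`Cruxes/LayeredLawsSelectHcp/LeadC3FarField.md`, §1, §5, §6): a bent or folded configuration must not bring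
a far label close to the root.  The mechanism is GREEDY DESCENT along bonds, from the atom `X u` to the
root star, counting bonds against the ideal label norm:

* `chart_step`: the greedy step `tube_starGreedyStep` at the atom `X u` in a unit direction `e` lands on an
  atom `X w` (the chart is onto `S`) at distance in `(0, 28/25]`, so — the chart's bond `iff`, right to
  left — the LABELS `u`, `w` are at ideal distance `1`, whence `‖hcpSite 1 √(2/3) u‖ ≤ ‖hcpSite 1 √(2/3) w‖ + 1`
  (`norm_ideal_le_of_dist_eq_one`);
* `chart_descent`: stepping towards the root (`e = −X u/‖X u‖`) gives
  `‖X w‖² ≤ ‖X u‖² − 1.254‖X u‖ + 1.0201`;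
* `ideal_norm_le_two` (base): an atom within `9/8` of the root `0 = X 0` is one of the root's shell atoms
  (`goodShell_dist_mem`), one bond from the root, so its label has ideal norm `1`; a label sent to the root
  itself is one bond from such an atom: ideal norm `≤ 2`;
* `ideal_norm_le_twelve` (middle range): ten greedy steps bring `‖X u‖ ≤ 5.95` down to `≤ 9/8`, through
  the thresholds `5.95, 5.39, 4.83, 4.28, 3.74, 3.22, 2.72, 2.24, 1.8, 1.42, 9/8`
  (`mid_step`: `r ≤ s ⇒ r² − 1.254 r + 1.0201 ≤ s² − 1.254 s + 1.0201 ≤ t²`), so ideal norm `≤ 12`;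
* `ideal_norm_far` (far range): while `‖X u‖ ≥ 11/2` a greedy step decreases `‖X ·‖` by `≥ 9/16`
  (`far_step`: `r² − 1.254 r + 1.0201 ≤ (r − 9/16)²` iff `r ≥ 5.455`), so
  `‖X u‖ ≤ 11/2 + (9/16) m ⇒ ‖hcpSite 1 √(2/3) u‖ ≤ m + 12`;
* **`tube_farRange`** (registered): `‖X u‖ ≥ (9/16)‖hcpSite 1 √(2/3) u‖ − 7` (with `m = ⌈(16/9)(‖X u‖ − 11/2)⌉₊`
  the bound is `(9/16)(m + 12) − 7 < ‖X u‖ − 5.19`).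

All `[folklore]`.
-/

noncomputable section

namespace Summit.AtomisticToContinuum.Crystallization.Theorems.PalmUnimodularRigidity.LayeredLawsSelectHcp

open Literature.MathematicalPhysics.StatisticalMechanics Literature.Geometry.DiscreteGeometry
open Summit.AtomisticToContinuum.Crystallization.Theorems.LayeredLawsSelectHcp.Negative.DiracLaws (GoodShell)

/-! ## One greedy step read through the chart -/

/-- Labels at ideal distance `1` have ideal norms differing by at most `1`. [folklore] -/
theorem norm_ideal_le_of_dist_eq_one {u w : ℤ × ℤ × ℤ}
    (h : dist (hcpSite 1 (Real.sqrt (2 / 3)) u) (hcpSite 1 (Real.sqrt (2 / 3)) w) = 1) :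
    ‖hcpSite 1 (Real.sqrt (2 / 3)) u‖ ≤ ‖hcpSite 1 (Real.sqrt (2 / 3)) w‖ + 1 := by
  have h1 := norm_sub_norm_le (hcpSite 1 (Real.sqrt (2 / 3)) u) (hcpSite 1 (Real.sqrt (2 / 3)) w)
  rw [← dist_eq_norm, h] at h1
  linarith

/-- **The greedy step read through the chart.**  From the atom `X u`, in every unit direction `e`, the
greedy step `tube_starGreedyStep` lands on an atom `X w` (the chart is onto `S`) at distance in
`(0, 101/100] ⊆ (0, 28/25]` with `⟪X w − X u, e⟫ ≥ 0.627`; by the chart's bond `iff` the labels `u`, `w`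
are at ideal distance `1`. [folklore] -/
theorem chart_step {S : Set (EuclideanSpace ℝ (Fin 3))} {X : ℤ × ℤ × ℤ → EuclideanSpace ℝ (Fin 3)}
    (hS : ∀ x ∈ S, GoodShell S x) (hX : IsRootedChart S X) (u : ℤ × ℤ × ℤ)
    {e : EuclideanSpace ℝ (Fin 3)} (he : ‖e‖ = 1) :
    ∃ w : ℤ × ℤ × ℤ, dist (hcpSite 1 (Real.sqrt (2 / 3)) u) (hcpSite 1 (Real.sqrt (2 / 3)) w) = 1 ∧
      X w ≠ X u ∧ dist (X w) (X u) ≤ 101 / 100 ∧ 627 / 1000 ≤ inner ℝ (X w - X u) e := by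
  obtain ⟨-, hXS, honto, hiff⟩ := hX
  obtain ⟨y', hy'S, hlo, hhi, hinner⟩ := tube_starGreedyStep S (X u) (hS _ (hXS u)) e he
  obtain ⟨w, rfl⟩ := honto y' hy'S
  refine ⟨w, (hiff u w).2 ⟨?_, ?_⟩, ?_, hhi, hinner⟩
  · rw [dist_comm]; linarith
  · rw [dist_comm]; linarith
  · intro h
    rw [h, dist_self] at hlo
    linarith

/-- **Descent of the length.**  Stepping from an atom `X u ≠ 0` towards the root (`e = −X u/‖X u‖`) reaches
a label `w` at ideal distance `1` from `u` with `‖X w‖² ≤ ‖X u‖² − 1.254‖X u‖ + 1.0201`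
(`‖X w‖² = ‖X w − X u‖² + 2⟪X w − X u, X u⟫ + ‖X u‖²`, `‖X w − X u‖ ≤ 1.01`,
`⟪X w − X u, X u⟫ ≤ −0.627‖X u‖`). [folklore] -/
theorem chart_descent {S : Set (EuclideanSpace ℝ (Fin 3))} {X : ℤ × ℤ × ℤ → EuclideanSpace ℝ (Fin 3)}
    (hS : ∀ x ∈ S, GoodShell S x) (hX : IsRootedChart S X) {u : ℤ × ℤ × ℤ} (hu : X u ≠ 0) :
    ∃ w : ℤ × ℤ × ℤ, dist (hcpSite 1 (Real.sqrt (2 / 3)) u) (hcpSite 1 (Real.sqrt (2 / 3)) w) = 1 ∧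
      ‖X w‖ ^ 2 ≤ ‖X u‖ ^ 2 - 1254 / 1000 * ‖X u‖ + 10201 / 10000 := by
  have hr : 0 < ‖X u‖ := norm_pos_iff.2 hu
  have he : ‖-(‖X u‖⁻¹ • X u)‖ = 1 := by
    rw [norm_neg, norm_smul, norm_inv, norm_norm, inv_mul_cancel₀ hr.ne']
  obtain ⟨w, hdist, -, hhi, hinner⟩ := chart_step hS hX u he
  refine ⟨w, hdist, ?_⟩
  have hinner' : inner ℝ (X w - X u) (X u) = -‖X u‖ * inner ℝ (X w - X u) (-(‖X u‖⁻¹ • X u)) := by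
    rw [inner_neg_right, real_inner_smul_right]
    field_simp
  have hsq : ‖X w‖ ^ 2 = ‖X w - X u‖ ^ 2 + 2 * inner ℝ (X w - X u) (X u) + ‖X u‖ ^ 2 := by
    rw [← norm_add_sq_real, sub_add_cancel]
  have h1 : ‖X w - X u‖ ≤ 101 / 100 := by rwa [← dist_eq_norm]
  rw [hsq, hinner']
  nlinarith [mul_le_mul h1 h1 (norm_nonneg _) (by norm_num), mul_le_mul_of_nonneg_left hinner hr.le]

/-! ## The base: atoms near the root -/

/-- **Base of the descent.**  A label `u` whose atom lies within `9/8` of the root has ideal norm `≤ 2`: if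
`X u ≠ 0` it is a shell atom of the good root `0 = X 0` (`goodShell_dist_mem`: distance in
`[0.891, 1.01] ⊆ (0, 28/25]`), one bond from the root, so `‖hcpSite 1 √(2/3) u‖ = 1`; if `X u = 0`, one
greedy step reaches such a shell atom. [folklore] -/
theorem ideal_norm_le_two {S : Set (EuclideanSpace ℝ (Fin 3))} {X : ℤ × ℤ × ℤ → EuclideanSpace ℝ (Fin 3)}
    (hS : ∀ x ∈ S, GoodShell S x) (hX : IsRootedChart S X) {u : ℤ × ℤ × ℤ} (hu : ‖X u‖ ≤ 9 / 8) :
    ‖hcpSite 1 (Real.sqrt (2 / 3)) u‖ ≤ 2 := by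
  have h0 : hcpSite 1 (Real.sqrt (2 / 3)) 0 = 0 := barlowPos_alternating_zero 1 (Real.sqrt (2 / 3))
  have hgood : GoodShell S 0 := by
    have h := hS _ (hX.2.1 0)
    rwa [hX.1] at h
  -- an atom `X w ≠ 0` within `9/8` of the root has a label of ideal norm `1`
  have key : ∀ w, X w ≠ 0 → ‖X w‖ ≤ 9 / 8 → ‖hcpSite 1 (Real.sqrt (2 / 3)) w‖ = 1 := by
    intro w hw0 hw
    obtain ⟨-, hhi⟩ := goodShell_dist_mem hgood (hX.2.1 w) hw0 (by rwa [dist_zero_right])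
    rw [dist_zero_right] at hhi
    have h1 : dist (hcpSite 1 (Real.sqrt (2 / 3)) w) (hcpSite 1 (Real.sqrt (2 / 3)) 0) = 1 := by
      refine (hX.2.2.2 w 0).2 ⟨?_, ?_⟩
      · rw [hX.1, dist_zero_right]
        exact norm_pos_iff.2 hw0
      · rw [hX.1, dist_zero_right]
        linarith
    rwa [h0, dist_zero_right] at h1
  by_cases hu0 : X u = 0
  · have he : ‖(EuclideanSpace.single (0 : Fin 3) (1 : ℝ) : EuclideanSpace ℝ (Fin 3))‖ = 1 := by simp
    obtain ⟨w, hdist, hne, hhi, -⟩ := chart_step hS hX u he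
    rw [hu0] at hne hhi
    rw [dist_zero_right] at hhi
    have hw := key w hne (by linarith)
    have := norm_ideal_le_of_dist_eq_one hdist
    linarith
  · linarith [key u hu0 hu]

/-! ## The middle range: ten thresholds -/

/-- The one-step bound is monotone in the starting radius on `[0, s]` once `s ≥ 1.254`:
`r² − 1.254 r + 1.0201 ≤ s² − 1.254 s + 1.0201 ≤ t²`. [folklore] -/
theorem mid_step {r s t : ℝ} (hr0 : 0 ≤ r) (hrs : r ≤ s) (hs : 1254 / 1000 ≤ s)
    (hst : s ^ 2 - 1254 / 1000 * s + 10201 / 10000 ≤ t ^ 2) :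
    r ^ 2 - 1254 / 1000 * r + 10201 / 10000 ≤ t ^ 2 := by
  nlinarith [mul_nonneg hr0 (sub_nonneg.2 hrs), mul_nonneg (sub_nonneg.2 hrs) (sub_nonneg.2 hs)]

/-- **Lifting a threshold.**  If every label whose atom lies within `t` of the root has ideal norm `≤ k`,
and one greedy step from radius `≤ s` lands within `t` (`s² − 1.254 s + 1.0201 ≤ t²`, `s ≥ 1.254`), then
every label whose atom lies within `s` has ideal norm `≤ k + 1`. [folklore] -/
theorem mid_lift {S : Set (EuclideanSpace ℝ (Fin 3))} {X : ℤ × ℤ × ℤ → EuclideanSpace ℝ (Fin 3)}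
    (hS : ∀ x ∈ S, GoodShell S x) (hX : IsRootedChart S X) (s t k k' : ℝ) (ht0 : 0 ≤ t)
    (hs : 1254 / 1000 ≤ s) (hst : s ^ 2 - 1254 / 1000 * s + 10201 / 10000 ≤ t ^ 2) (hk : k + 1 = k')
    (ih : ∀ w, ‖X w‖ ≤ t → ‖hcpSite 1 (Real.sqrt (2 / 3)) w‖ ≤ k) :
    ∀ u, ‖X u‖ ≤ s → ‖hcpSite 1 (Real.sqrt (2 / 3)) u‖ ≤ k' := by
  intro u hu
  by_cases hu0 : X u = 0
  · have h := ih u (by rw [hu0, norm_zero]; exact ht0)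
    linarith
  obtain ⟨w, hdist, hdesc⟩ := chart_descent hS hX hu0
  have h2 : ‖X w‖ ^ 2 ≤ t ^ 2 := hdesc.trans (mid_step (norm_nonneg _) hu hs hst)
  have hw : ‖X w‖ ≤ t := (abs_le_of_sq_le_sq' h2 ht0).2
  have h3 := ih w hw
  have h4 := norm_ideal_le_of_dist_eq_one hdist
  linarith

/-- **The middle range.**  Every label whose atom lies within `5.95` of the root has ideal norm `≤ 12`: ten
lifts through the thresholds `9/8, 1.42, 1.8, 2.24, 2.72, 3.22, 3.74, 4.28, 4.83, 5.39, 5.95` from the base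
`ideal_norm_le_two`. [folklore] -/
theorem ideal_norm_le_twelve {S : Set (EuclideanSpace ℝ (Fin 3))} {X : ℤ × ℤ × ℤ → EuclideanSpace ℝ (Fin 3)}
    (hS : ∀ x ∈ S, GoodShell S x) (hX : IsRootedChart S X) :
    ∀ u, ‖X u‖ ≤ 595 / 100 → ‖hcpSite 1 (Real.sqrt (2 / 3)) u‖ ≤ 12 := by
  have h2 : ∀ u, ‖X u‖ ≤ 9 / 8 → ‖hcpSite 1 (Real.sqrt (2 / 3)) u‖ ≤ 2 :=
    fun u hu => ideal_norm_le_two hS hX hu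
  have h3 := mid_lift hS hX (142 / 100) (9 / 8) 2 3 (by norm_num) (by norm_num) (by norm_num) (by norm_num) h2
  have h4 := mid_lift hS hX (18 / 10) (142 / 100) 3 4 (by norm_num) (by norm_num) (by norm_num) (by norm_num) h3
  have h5 := mid_lift hS hX (224 / 100) (18 / 10) 4 5 (by norm_num) (by norm_num) (by norm_num) (by norm_num) h4
  have h6 := mid_lift hS hX (272 / 100) (224 / 100) 5 6 (by norm_num) (by norm_num) (by norm_num) (by norm_num) h5
  have h7 := mid_lift hS hX (322 / 100) (272 / 100) 6 7 (by norm_num) (by norm_num) (by norm_num) (by norm_num) h6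
  have h8 := mid_lift hS hX (374 / 100) (322 / 100) 7 8 (by norm_num) (by norm_num) (by norm_num) (by norm_num) h7
  have h9 := mid_lift hS hX (428 / 100) (374 / 100) 8 9 (by norm_num) (by norm_num) (by norm_num) (by norm_num) h8
  have h10 := mid_lift hS hX (483 / 100) (428 / 100) 9 10 (by norm_num) (by norm_num) (by norm_num) (by norm_num) h9
  have h11 := mid_lift hS hX (539 / 100) (483 / 100) 10 11 (by norm_num) (by norm_num) (by norm_num) (by norm_num) h10
  exact mid_lift hS hX (595 / 100) (539 / 100) 11 12 (by norm_num) (by norm_num) (by norm_num) (by norm_num) h11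

/-! ## The far range: linear descent -/

/-- From radius `r ≥ 11/2` a greedy step decreases the length by `9/16`:
`r² − 1.254 r + 1.0201 ≤ (r − 9/16)²` (equality at `r = 5.455`). [folklore] -/
theorem far_step {r : ℝ} (hr : 11 / 2 ≤ r) :
    r ^ 2 - 1254 / 1000 * r + 10201 / 10000 ≤ (r - 9 / 16) ^ 2 := by
  nlinarith

/-- **The far range.**  `‖X u‖ ≤ 11/2 + (9/16) m ⇒ ‖hcpSite 1 √(2/3) u‖ ≤ m + 12` (induction on `m`: below
`11/2` the middle range, above it one greedy step decreases the length by `9/16`). [folklore] -/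
theorem ideal_norm_far {S : Set (EuclideanSpace ℝ (Fin 3))} {X : ℤ × ℤ × ℤ → EuclideanSpace ℝ (Fin 3)}
    (hS : ∀ x ∈ S, GoodShell S x) (hX : IsRootedChart S X) :
    ∀ m : ℕ, ∀ u, ‖X u‖ ≤ 11 / 2 + 9 / 16 * (m : ℝ) → ‖hcpSite 1 (Real.sqrt (2 / 3)) u‖ ≤ (m : ℝ) + 12 := by
  intro m
  induction m with
  | zero =>
    intro u hu
    rw [Nat.cast_zero, mul_zero, add_zero] at hu
    rw [Nat.cast_zero, zero_add]
    exact ideal_norm_le_twelve hS hX u (by linarith)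
  | succ m ih =>
    intro u hu
    push_cast at hu ⊢
    rcases le_or_gt ‖X u‖ (11 / 2 + 9 / 16 * (m : ℝ)) with hle | hlt
    · have h := ih u hle
      linarith
    have hm0 : (0 : ℝ) ≤ 9 / 16 * (m : ℝ) := by positivity
    have h112 : 11 / 2 ≤ ‖X u‖ := by linarith
    have hu0 : X u ≠ 0 := by
      intro h
      rw [h, norm_zero] at h112
      linarith
    obtain ⟨w, hdist, hdesc⟩ := chart_descent hS hX hu0
    have hw2 : ‖X w‖ ^ 2 ≤ (‖X u‖ - 9 / 16) ^ 2 := hdesc.trans (far_step h112)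
    have hw : ‖X w‖ ≤ ‖X u‖ - 9 / 16 := (abs_le_of_sq_le_sq' hw2 (by linarith)).2
    have h3 := ih w (by linarith)
    have h4 := norm_ideal_le_of_dist_eq_one hdist
    linarith

/-! ## The stub -/

/-- **Registered stub `tube_farRange` (G2): far labels stay far.**  For every rooted chart `X` of an
every-point-good configuration, `‖X u‖ ≥ (9/16)‖hcpSite 1 √(2/3) u‖ − 7` for every label `u`: greedy descent
from `X u` to the root star takes at most `m + 12` bonds, `m = ⌈(16/9)(‖X u‖ − 11/2)⌉₊` (none of the far kind
when `‖X u‖ ≤ 11/2`), and each bond changes the label by an ideal unit strut. [folklore] -/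
theorem tube_farRange : ∀ (S : Set (EuclideanSpace ℝ (Fin 3))), (∀ x ∈ S, GoodShell S x) → ∀ X : ℤ × ℤ × ℤ → EuclideanSpace ℝ (Fin 3), IsRootedChart S X → ∀ u : ℤ × ℤ × ℤ, 9 / 16 * ‖hcpSite 1 (Real.sqrt (2 / 3)) u‖ - 7 ≤ ‖X u‖ := by
  intro S hS X hX u
  rcases le_or_gt ‖X u‖ (11 / 2) with hle | hlt
  · have h12 := ideal_norm_le_twelve hS hX u (by linarith)
    linarith [norm_nonneg (X u)]
  · have hpos : (0 : ℝ) ≤ (‖X u‖ - 11 / 2) * (16 / 9) := mul_nonneg (by linarith) (by norm_num)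
    have hm1 : (‖X u‖ - 11 / 2) * (16 / 9) ≤ (⌈(‖X u‖ - 11 / 2) * (16 / 9)⌉₊ : ℝ) := Nat.le_ceil _
    have hm2 : (⌈(‖X u‖ - 11 / 2) * (16 / 9)⌉₊ : ℝ) < (‖X u‖ - 11 / 2) * (16 / 9) + 1 :=
      Nat.ceil_lt_add_one hpos
    have h := ideal_norm_far hS hX ⌈(‖X u‖ - 11 / 2) * (16 / 9)⌉₊ u (by linarith)
    linarith

end Summit.AtomisticToContinuum.Crystallization.Theorems.PalmUnimodularRigidity.LayeredLawsSelectHcp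

end
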